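import Literature.IUT.LogVolume.MultiradialRegion
import HarnessLib

/-!
# Packet models assembled prime by prime (Dupuy–Hilado, *The statement of Mochizuki's Corollary
# 3.12*, Def. 3.6.3 "`𝕃 = Π_p 𝕃_p`")

Dupuy–Hilado, arXiv:2004.13228 (pre-split text), Def. 3.6.3, read on the page (render chunk 12): "We define
`𝕃 = Π_p 𝕃_p`, `ln ν̄_𝕃(B) = Σ_p ln ν̄_{𝕃_p}(B_p)`. Also, we define `𝕃_p = ⊕_{j=1}^{(l−1)/2} 𝔸^{⊗ j+1}_{V̲,p}`";
§4.7: "for all `p`, the action of Ind1 on `𝔸^{⊗ j+1}_{V̲,p}` is simultaneous"; §4.9: Ind2 acts "as products of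
the automorphisms on each of the summands"; §4.12: "it suffices to define hulls locally … `hull(Ω) := Π_p
hull(Ω_p)`". Every datum and every axiom of the interface `IndPacketModel` (`MultiradialRegion.lean`) is
thus LOCAL AT `p`: nothing relates the summands over two different primes.

This file records that structure, for use by the concrete tensor-packet model (`TensorPacketModel.lean`):

* `PrimePacket F p` — the data and axioms of `IndPacketModel F` AT ONE index `p` (summands `X_{v⃗}` for
  `v⃗ ∈ V(F)_p^{j+1}`, admissibility, `log μ̄`, `O`, local scalars `Λ_v` (`v | p`) with `ord_v` and their peel
  action, log-shells, (Ind1) transports, (Ind2) groups, local hulls), field for field;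
* `IndPacketModel.ofPrimewise` — a family `(P_p)_p` of prime packets IS an `IndPacketModel` (and
  `IndPacketModel.primePart` recovers `P_p`, `primePart_ofPrimewise`);
* `PrimePacket.trivial` — the one-point packet (every axiom holds by `rfl`), and `IndPacketModel.ofPrimes` —
  the model built from prime packets given AT PRIMES ONLY, completed by the one-point packet at non-prime
  indices. DESIGN NOTE (why this exists): the interface is indexed by ALL `p : ℕ` and the index set
  `placesOver F p` of `FakeAdeleIndex.lean` is junk but NON-EMPTY at composite `p` (it is the set of places
  over the prime divisors of `p`), while the tensor packet `K_{v̲_0} ⊗_{ℚ_p} ⋯ ⊗_{ℚ_p} K_{v̲_j}` needs `ℚ_p`,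
  i.e. `p` prime. Rather than branching inside each field (which would put casts between the summand, its
  measure and its scalars at every prime), the branch is taken ONCE, on the whole packet: at a prime `p` the
  `p`-part of `ofPrimes P` is LITERALLY `P p hp` (`primePart_ofPrimes`, `ofPrimes_elim`), so per-prime
  statements transfer without casts. Log-measures `ln ν̄_𝕃` are only ever summed over finite sets of PRIMES
  (`PacketModel.lnνL`, `DHData.T_prime`), so the completion at composite indices is never read.

[cite: DupuyHilado2025, Def. 3.6.3, §4.7, §4.9, §4.12] Pure bookkeeping over the interface; no measure
theory, no disputed statement. Deliberately NOT here: any concrete packet.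
-/

noncomputable section

namespace Literature.IUT.LogVolume

open NumberField IsDedekindDomain
open scoped Pointwise

universe u

variable (F : Type u) [Field F] [NumberField F]

/-! ## The data of a packet model at one prime -/

/-- **A packet with indeterminacies at the index `p`**: the fields of `IndPacketModel F` (and of the
underlying `PacketModel F`) restricted to the summands `X_{v⃗}`, `v⃗ ∈ V(F)_p^{j+1}`, and the scalars `Λ_v`,
`v ∈ V(F)_p` — Dupuy–Hilado's `𝕃_p = ⊕_j 𝔸^{⊗ j+1}_{V̲,p}` with its normalised log-measures, integral
structures, peel actions ((3.7) with (3.4)), log-shells `I_{v⃗}`, (Ind1) transports, (Ind2) groups and local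
hulls. Docstrings of the individual fields: see `PacketModel` / `IndPacketModel`, which this copies at
fixed `p`. [cite: DupuyHilado2025, Def. 3.6.1, Def. 3.6.3, §3.7–3.9, §4.7, §4.9, §4.12] -/
structure PrimePacket (p : ℕ) where
  /-- the summand `X_{v⃗} = K_{v̲_0} ⊗ ⋯ ⊗ K_{v̲_j}`, `v⃗ ∈ V(F)_p^{j+1}` -/
  X : (j : ℕ) → (Fin (j + 1) → placesOver F p) → Type
  /-- admissible subsets of `X_{v⃗}` -/
  adm : {j : ℕ} → {e : Fin (j + 1) → placesOver F p} → Set (X j e) → Prop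
  /-- the normalised log-measure `log μ̄_{v⃗}` -/
  logμ : {j : ℕ} → {e : Fin (j + 1) → placesOver F p} → Set (X j e) → ℝ
  /-- `log μ̄_{v⃗}` is monotone on admissible sets -/
  logμ_mono : ∀ {j : ℕ} {e : Fin (j + 1) → placesOver F p} {A B : Set (X j e)},
    adm A → adm B → A ⊆ B → logμ A ≤ logμ B
  /-- the integral structure `O_{v⃗}` -/
  O : (j : ℕ) → (e : Fin (j + 1) → placesOver F p) → Set (X j e)
  /-- `O_{v⃗}` is admissible -/
  O_adm : ∀ (j : ℕ) (e : Fin (j + 1) → placesOver F p), adm (O j e)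
  /-- `log μ̄_{v⃗}(O_{v⃗}) = 0` -/
  logμ_O : ∀ (j : ℕ) (e : Fin (j + 1) → placesOver F p), logμ (O j e) = 0
  /-- local scalars `Λ_v` at `v | p` -/
  Λ : placesOver F p → Type
  /-- `ord_v : Λ_v → ℝ` -/
  ordv : {v : placesOver F p} → Λ v → ℝ
  /-- the peel action through the last tensor factor -/
  peel : {j : ℕ} → {e : Fin (j + 1) → placesOver F p} → Λ (e (Fin.last j)) → X j e → X j e
  /-- it preserves admissibility -/
  peel_adm : ∀ {j : ℕ} {e : Fin (j + 1) → placesOver F p} (a : Λ (e (Fin.last j))) {U : Set (X j e)},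
    adm U → adm (peel a '' U)
  /-- (3.7) with (3.4) -/
  logμ_peel : ∀ {j : ℕ} {e : Fin (j + 1) → placesOver F p} (a : Λ (e (Fin.last j))) {U : Set (X j e)},
    adm U → logμ (peel a '' U) =
      -(ordv a) * logNorm F (e (Fin.last j)).1 / localDegree F (e (Fin.last j)).1 + logμ U
  /-- the log-shell lattice `I_{v⃗}` -/
  shell : (j : ℕ) → (e : Fin (j + 1) → placesOver F p) → Set (X j e)
  /-- `I_{v⃗}` is admissible -/
  shell_adm : ∀ (j : ℕ) (e : Fin (j + 1) → placesOver F p), adm (shell j e)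
  /-- (Ind1) transport along `σ` -/
  perm : {j : ℕ} → (σ : Equiv.Perm (Fin (j + 1))) → (e : Fin (j + 1) → placesOver F p) →
    X j (e ∘ σ) ≃ X j e
  /-- transport along `1` is the identity -/
  perm_one : ∀ {j : ℕ} (e : Fin (j + 1) → placesOver F p) (x : X j e), perm 1 e x = x
  /-- (Ind1) preserves admissibility -/
  perm_adm : ∀ {j : ℕ} (σ : Equiv.Perm (Fin (j + 1))) (e : Fin (j + 1) → placesOver F p)
    {U : Set (X j (e ∘ σ))}, adm U → adm (perm σ e '' U)
  /-- (Ind1) preserves `log μ̄` -/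
  logμ_perm : ∀ {j : ℕ} (σ : Equiv.Perm (Fin (j + 1))) (e : Fin (j + 1) → placesOver F p)
    {U : Set (X j (e ∘ σ))}, adm U → logμ (perm σ e '' U) = logμ U
  /-- (Ind1) fixes the lattice -/
  perm_shell : ∀ {j : ℕ} (σ : Equiv.Perm (Fin (j + 1))) (e : Fin (j + 1) → placesOver F p),
    perm σ e '' shell j (e ∘ σ) = shell j e
  /-- the (Ind2) group at `v⃗` -/
  G₂ : (j : ℕ) → (Fin (j + 1) → placesOver F p) → Type
  /-- it is a group -/
  [group₂ : ∀ j e, Group (G₂ j e)]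
  /-- acting on the summand -/
  [action₂ : ∀ j e, MulAction (G₂ j e) (X j e)]
  /-- (Ind2) preserves admissibility -/
  smul_adm : ∀ {j : ℕ} {e : Fin (j + 1) → placesOver F p} (g : G₂ j e) {U : Set (X j e)},
    adm U → adm (g • U)
  /-- (Ind2) preserves `log μ̄` -/
  logμ_smul : ∀ {j : ℕ} {e : Fin (j + 1) → placesOver F p} (g : G₂ j e) {U : Set (X j e)},
    adm U → logμ (g • U) = logμ U
  /-- (Ind2) preserves the lattice -/
  smul_shell : ∀ {j : ℕ} {e : Fin (j + 1) → placesOver F p} (g : G₂ j e), g • shell j e = shell j e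
  /-- the local hull, a closure operator -/
  hullLoc : (j : ℕ) → (e : Fin (j + 1) → placesOver F p) → ClosureOperator (Set (X j e))

attribute [instance] PrimePacket.group₂ PrimePacket.action₂

variable {F}

/-! ## Assembling a model from its prime parts -/

/-- **A family of prime packets is a packet model with indeterminacies** ("`𝕃 = Π_p 𝕃_p`"): every field
of `IndPacketModel F` at the index `p` is the corresponding field of `P p`.
[cite: DupuyHilado2025, Def. 3.6.3, §4.7, §4.9, §4.12] -/
def IndPacketModel.ofPrimewise (P : ∀ p : ℕ, PrimePacket F p) : IndPacketModel F where
  X p j e := (P p).X j e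
  adm {p _ _} A := (P p).adm A
  logμ {p _ _} A := (P p).logμ A
  logμ_mono {p _ _ _ _} hA hB h := (P p).logμ_mono hA hB h
  O p j e := (P p).O j e
  O_adm p j e := (P p).O_adm j e
  logμ_O p j e := (P p).logμ_O j e
  Λ p v := (P p).Λ v
  ordv {p _} a := (P p).ordv a
  peel {p _ _} a x := (P p).peel a x
  peel_adm {p _ _} a _ hU := (P p).peel_adm a hU
  logμ_peel {p _ _} a _ hU := (P p).logμ_peel a hU
  shell p j e := (P p).shell j e
  shell_adm p j e := (P p).shell_adm j e
  perm {p _} σ e := (P p).perm σ e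
  perm_one {p _} e x := (P p).perm_one e x
  perm_adm {p _} σ e _ hU := (P p).perm_adm σ e hU
  logμ_perm {p _} σ e _ hU := (P p).logμ_perm σ e hU
  perm_shell {p _} σ e := (P p).perm_shell σ e
  G₂ p j e := (P p).G₂ j e
  group₂ p j e := (P p).group₂ j e
  action₂ p j e := (P p).action₂ j e
  smul_adm {p _ _} g _ hU := (P p).smul_adm g hU
  logμ_smul {p _ _} g _ hU := (P p).logμ_smul g hU
  smul_shell {p _ _} g := (P p).smul_shell g
  hullLoc p j e := (P p).hullLoc j e

/-- **The `p`-part of a packet model**: its fields at the index `p`, as a prime packet.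
[cite: DupuyHilado2025, Def. 3.6.3] -/
def IndPacketModel.primePart (M : IndPacketModel F) (p : ℕ) : PrimePacket F p where
  X j e := M.X p j e
  adm A := M.adm A
  logμ A := M.logμ A
  logμ_mono hA hB h := M.logμ_mono hA hB h
  O j e := M.O p j e
  O_adm j e := M.O_adm p j e
  logμ_O j e := M.logμ_O p j e
  Λ v := M.Λ p v
  ordv a := M.ordv a
  peel a x := M.peel a x
  peel_adm a _ hU := M.peel_adm a hU
  logμ_peel a _ hU := M.logμ_peel a hU
  shell j e := M.shell p j e
  shell_adm j e := M.shell_adm p j e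
  perm σ e := M.perm σ e
  perm_one e x := M.perm_one e x
  perm_adm σ e _ hU := M.perm_adm σ e hU
  logμ_perm σ e _ hU := M.logμ_perm σ e hU
  perm_shell σ e := M.perm_shell σ e
  G₂ j e := M.G₂ p j e
  group₂ j e := M.group₂ p j e
  action₂ j e := M.action₂ p j e
  smul_adm g _ hU := M.smul_adm g hU
  logμ_smul g _ hU := M.logμ_smul g hU
  smul_shell g := M.smul_shell g
  hullLoc j e := M.hullLoc p j e

/-- The `p`-part of the assembled model is the given prime packet (definitionally).
[cite: DupuyHilado2025, Def. 3.6.3] -/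
@[simp] theorem IndPacketModel.primePart_ofPrimewise (P : ∀ p : ℕ, PrimePacket F p) (p : ℕ) :
    (IndPacketModel.ofPrimewise P).primePart p = P p := rfl

/-! ## The one-point packet and the completion at non-prime indices -/

namespace PrimePacket

/-- The trivial action of the one-element group on the one-point type. [folklore] -/
@[reducible] def unitAction : MulAction PUnit.{1} PUnit.{1} where
  smul _ x := x
  one_smul _ := rfl
  mul_smul _ _ _ := rfl

variable (F) in
/-- **The one-point packet**: every summand and every group of scalars is a point, the only admissible
set is everything, all log-measures and valuations are `0`, transports and actions are identities, the hull
is the identity closure operator — every axiom of the interface holds by `rfl`. Used ONLY to complete a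
family of genuine packets (given at primes) at the composite indices, where nothing is ever read.
[folklore] -/
def trivial (p : ℕ) : PrimePacket F p where
  X _ _ := PUnit
  adm _ := True
  logμ _ := 0
  logμ_mono _ _ _ := le_rfl
  O _ _ := Set.univ
  O_adm _ _ := True.intro
  logμ_O _ _ := rfl
  Λ _ := PUnit
  ordv _ := 0
  peel _ x := x
  peel_adm _ _ _ := True.intro
  logμ_peel _ _ _ := by simp
  shell _ _ := Set.univ
  shell_adm _ _ := True.intro
  perm _ _ := Equiv.refl PUnit
  perm_one _ _ := rfl
  perm_adm _ _ _ _ := True.intro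
  logμ_perm _ _ _ _ := rfl
  perm_shell _ _ := by simp
  G₂ _ _ := PUnit
  group₂ _ _ := inferInstance
  action₂ _ _ := unitAction
  smul_adm _ _ _ := True.intro
  logμ_smul _ _ _ := rfl
  smul_shell _ := by
    ext x
    exact ⟨fun _ => Set.mem_univ _, fun _ => ⟨x, Set.mem_univ _, rfl⟩⟩
  hullLoc _ _ := ClosureOperator.id _

end PrimePacket

open Classical in
/-- **The model built from prime packets given at primes**, completed by the one-point packet at the
non-prime indices (see the module docstring's design note). [cite: DupuyHilado2025, Def. 3.6.3] -/
def IndPacketModel.ofPrimes (P : ∀ p : ℕ, p.Prime → PrimePacket F p) : IndPacketModel F :=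
  IndPacketModel.ofPrimewise fun p => if hp : p.Prime then P p hp else PrimePacket.trivial F p

/-- **At a prime `p`, the `p`-part of `ofPrimes P` IS `P p`** — the transfer lemma for per-prime
statements. [cite: DupuyHilado2025, Def. 3.6.3] -/
theorem IndPacketModel.primePart_ofPrimes (P : ∀ p : ℕ, p.Prime → PrimePacket F p) {p : ℕ}
    (hp : p.Prime) : (IndPacketModel.ofPrimes P).primePart p = P p hp := by
  classical
  rw [IndPacketModel.ofPrimes, IndPacketModel.primePart_ofPrimewise, dif_pos hp]

/-- At a non-prime index the `p`-part of `ofPrimes P` is the one-point packet.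
[cite: DupuyHilado2025, Def. 3.6.3] -/
theorem IndPacketModel.primePart_ofPrimes_of_not_prime (P : ∀ p : ℕ, p.Prime → PrimePacket F p)
    {p : ℕ} (hp : ¬ p.Prime) : (IndPacketModel.ofPrimes P).primePart p = PrimePacket.trivial F p := by
  classical
  rw [IndPacketModel.ofPrimes, IndPacketModel.primePart_ofPrimewise, dif_neg hp]

/-- **Transfer**: a property of prime packets that holds for `P p hp` holds for the `p`-part of
`ofPrimes P`. [cite: DupuyHilado2025, Def. 3.6.3] -/
theorem IndPacketModel.ofPrimes_elim (P : ∀ p : ℕ, p.Prime → PrimePacket F p) {p : ℕ} (hp : p.Prime)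
    (C : PrimePacket F p → Prop) (h : C (P p hp)) : C ((IndPacketModel.ofPrimes P).primePart p) := by
  rw [IndPacketModel.primePart_ofPrimes P hp]
  exact h

/-! ## Regions and log-measures read prime by prime -/

namespace PrimePacket

variable {p : ℕ} (Q : PrimePacket F p)

/-- A region of the `p`-part: one subset of each summand `X_{v⃗}`, `v⃗ ∈ V(F)_p^{j+1}`.
[cite: DupuyHilado2025, Def. 3.5.1] -/
abbrev Region : Type _ := (j : ℕ) → (e : Fin (j + 1) → placesOver F p) → Set (Q.X j e)

/-- Admissibility of a region of the `p`-part. [cite: DupuyHilado2025, Def. 3.5.1] -/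
def RegionAdm (B : Q.Region) : Prop := ∀ j e, Q.adm (B j e)

/-- `ln ν̄_{𝔸^{⊗ j+1}_{V̲,p}}(B) = Σ_{v⃗} log μ̄_{v⃗}(B_{v⃗})·Π_k Pr(v_k)` for a region of the `p`-part (the same
formula as `PacketModel.lnνTensorPower`). [cite: DupuyHilado2025, §3.6, Def. 3.6.3] -/
def lnνTensorPower (j : ℕ) (B : Q.Region) : ℝ :=
  ∑ e : Fin (j + 1) → placesOver F p, Q.logμ (B j e) * ∏ i, weight F (e i).1

/-- `ln ν̄_{𝕃_p}(B) = (1/ℓ⋇) Σ_{j=1}^{ℓ⋇} ln ν̄_{𝔸^{⊗ j+1}}(B)` for a region of the `p`-part (the same formula as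
`PacketModel.lnνLp`). [cite: DupuyHilado2025, Def. 3.6.3] -/
def lnνLp (lstar : ℕ) (B : Q.Region) : ℝ :=
  (1 / (lstar : ℝ)) * ∑ i : Fin lstar, Q.lnνTensorPower ((i : ℕ) + 1) B

end PrimePacket

/-- The `p`-component of a region of a model is a region of its `p`-part (definitionally the same sets).
[cite: DupuyHilado2025, Def. 3.5.1] -/
abbrev IndPacketModel.regionAt (M : IndPacketModel F) (B : M.Region) (p : ℕ) : (M.primePart p).Region :=
  fun j e => B p j e

/-- `ln ν̄_{𝕃_p}` of a model is `ln ν̄_{𝕃_p}` of its `p`-part (definitionally). [cite: DupuyHilado2025, Def. 3.6.3] -/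
theorem IndPacketModel.lnνLp_eq_primePart (M : IndPacketModel F) (lstar p : ℕ) (B : M.Region) :
    M.lnνLp lstar p B = (M.primePart p).lnνLp lstar (M.regionAt B p) := rfl

/-- `ln ν̄_𝕃` over a finite set `T` is the sum of the `p`-parts' `ln ν̄_{𝕃_p}`. [cite: DupuyHilado2025, Def. 3.6.3] -/
theorem IndPacketModel.lnνL_eq_sum_primePart (M : IndPacketModel F) (lstar : ℕ) (T : Finset ℕ)
    (B : M.Region) : M.lnνL lstar T B = ∑ p ∈ T, (M.primePart p).lnνLp lstar (M.regionAt B p) := rfl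

end Literature.IUT.LogVolume

end
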